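import Summits.KontsevichZagierPeriods.KontsevichZagierPeriods.Theorems.OctahedralSymmetryOctahedralSpanAllWeightsStubElimEndGlue
import Mathlib.LinearAlgebra.Span.Basic
import HarnessLib

/-!
# Crux `OctahedralSpanAllWeights` (stmt-KontsevichZagierPeriods-9659), line `Sketch`: stub `stub_elim_lex_glue`

Helper file for the unit-pole filtration argument of the line `Sketch` for the crux
`OctaSpan.OctahedralSpanAllWeights` (route `OctahedralSymmetry`, problem `KontsevichZagierPeriods`).
Letters `Fin 5`: `0` = pole `1`, `4` = pole `0`, `1, 2, 3` = unit poles; words are read outer → inner;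
`IsConvergent W` = "`W` does not begin with `0` and does not end with `4`"; `rel` = the relation module.

Block **E** of the skeleton (v6, lead c3) targets the LEXICOGRAPHIC span: a convergent word `W` with a
letter `0` reduces, modulo `rel`, to convergent words of the same length with FEWER letters `0`, or with
AS MANY letters `0` and FEWER letters `4`:
`LEX W := span ℚ {[V] : |V| = |W|, V convergent, #0(V) < #0(W) ∨ (#0(V) = #0(W) ∧ #4(V) < #4(W))}`
(written out in full everywhere below; no new definition is introduced).  This file is the port of the
landed glue `ElimEnd.elim_of_gt_of_end` (file `…StubElimEndGlue`, §4) from `lowerSpan` (fewer letters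
`0` only) to `LEX`, registered as the stub `OctaSpan.stub_elim_lex_glue`.

## What is proved

* `ElimLex.lexSpan_congr` (`LEX W` depends only on `|W|`, `#0(W)`, `#4(W)`),
  `ElimLex.lowerSpan_le_lexSpan` (`lowerSpan W ≤ LEX W`).
* `ElimLex.shuffle_mem_of_lexReducible` — **decomposables are reducible, lexicographic version**: if
  `[X] ∈ rel ⊔ LEX X` and `u` is convergent then `u ш X ∈ rel ⊔ span{[w]}`, `w` over the interleavings
  of `u` with the `LEX X`-words (`rel` is a shuffle ideal, `ElimEnd.liftMap_mem_rel`).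
* `ElimLex.elimLex_le_of_end_at` — the `p`-reduction at a fixed length `n`: given E (lexicographic) at
  all lengths `< n` and the end case (words ending in `0`, `#0 ≤ #4`) at length `n`, every convergent
  `A ++ 0 :: B` of length `n` with a `0`-free tail `B` and `#0 ≤ #4` reduces.  Proof: `[A0]` reduces at
  the smaller length; multiply by the convergent `0`-free word `B`: an interleaving `w` of `B` with a
  lower word `V` (`|V| = |A0|`) has `#0(w) = #0(V)` and `#4(w) = #4(B) + #4(V)` (letter counts add under
  shuffling), while `#0(W) = #0(A0)` and `#4(W) = #4(A0) + #4(B)`, so `w` is lexicographically lower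
  than `W`; and `B ш A0 = [W] + Σ [w' 0 B₂]` over the proper `0`-free tails `B₂` of `B`
  (`ElimEnd.mem_shuffleWord_append_zero`), words with the same letters as `W`, handled by strong
  induction on `|B|`; `[W]` is isolated over `ℚ` (`ElimEnd.sym_mem_of_sum_mem`).
* The registered stub `stub_elim_lex_glue`: E (lexicographic, all lengths) from (E1)
  `#4 < #0 ⇒ [W] ∈ rel ⊔ lowerSpan W` (landed, `stub_elim_gt`; note `lowerSpan W ≤ LEX W`) and (End)
  the end case given E at all smaller lengths; strong induction on the length with
  `elimLex_le_of_end_at` inside.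

## Sources

J. Zhao, *Standard relations of multiple polylogarithm values at roots of unity*, Doc. Math. 15
(2010), §2 (Lemma 2.2: products of iterated integrals are shuffles; the relation module is a shuffle
ideal) [Zhao2010].  The rest is folklore bookkeeping (letter counts of interleavings).
-/

noncomputable section

namespace Summit.KontsevichZagierPeriods.OctahedralSymmetry.OctaSpan

open Literature.NumberTheory.Transcendental Literature.NumberTheory.Transcendental.LevelFour

namespace ElimLex

open ElimEnd
open Summit.KontsevichZagierPeriods.FurushoPentagon.DoubleShuffleOfPentagon (count_of_mem_shuffleWord)

/-! ## 1. The lexicographic span -/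

/-- The lexicographic span `LEX W` only depends on the length, on `#0` and on `#4`. [folklore] -/
theorem lexSpan_congr {V W : List (Fin 5)} (hlen : V.length = W.length)
    (h0 : V.count 0 = W.count 0) (h4 : V.count 4 = W.count 4) :
    Submodule.span ℚ (sym '' {U | U.length = V.length ∧ IsConvergent U ∧
      (U.count 0 < V.count 0 ∨ (U.count 0 = V.count 0 ∧ U.count 4 < V.count 4))}) =
    Submodule.span ℚ (sym '' {U | U.length = W.length ∧ IsConvergent U ∧
      (U.count 0 < W.count 0 ∨ (U.count 0 = W.count 0 ∧ U.count 4 < W.count 4))}) := by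
  rw [hlen, h0, h4]

/-- Fewer letters `0` is lexicographically lower: `lowerSpan W ≤ LEX W`. [folklore] -/
theorem lowerSpan_le_lexSpan (W : List (Fin 5)) :
    lowerSpan W ≤ Submodule.span ℚ (sym '' {V | V.length = W.length ∧ IsConvergent V ∧
      (V.count 0 < W.count 0 ∨ (V.count 0 = W.count 0 ∧ V.count 4 < W.count 4))}) :=
  Submodule.span_mono (Set.image_mono fun _ ⟨hlen, hconv, hlt⟩ => ⟨hlen, hconv, Or.inl hlt⟩)

/-! ## 2. `rel` is a shuffle ideal: products with a lexicographically reducible factor -/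

/-- **Decomposables are reducible (lexicographic version).** If `[X]` reduces modulo `rel` to
convergent words of the same length that are lexicographically lower in `(#0, #4)`, then for every
convergent word `u` the shuffle product `u ш X` lies in `rel` plus the span of `[w]`, `w` ranging over
the interleavings of `u` with such words `V`; the target set `S` is any set containing these
interleavings. Mechanism: `rel` is stable under `u ш ·` (`ElimEnd.liftMap_mem_rel`).
[cite: Zhao2010, §2 Lemma 2.2] -/
theorem shuffle_mem_of_lexReducible {u X : List (Fin 5)} (hu : IsConvergent u)
    (hX : sym X ∈ rel ⊔ Submodule.span ℚ (sym '' {V | V.length = X.length ∧ IsConvergent V ∧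
      (V.count 0 < X.count 0 ∨ (V.count 0 = X.count 0 ∧ V.count 4 < X.count 4))}))
    {S : Set (List (Fin 5))}
    (hS : ∀ V w : List (Fin 5), V.length = X.length → IsConvergent V →
      (V.count 0 < X.count 0 ∨ (V.count 0 = X.count 0 ∧ V.count 4 < X.count 4)) →
      w ∈ MZV.shuffleWord u V → w ∈ S) :
    toQ (shuffle u X) ∈ rel ⊔ Submodule.span ℚ (sym '' S) := by
  obtain ⟨r, hr, l, hl, hsum⟩ := Submodule.mem_sup.1 hX
  rw [← liftMap_sym, ← hsum, map_add]
  refine Submodule.add_mem _ (Submodule.mem_sup_left (liftMap_mem_rel hu hr))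
    (Submodule.mem_sup_right ?_)
  have key : Submodule.map (liftMap u)
      (Submodule.span ℚ (sym '' {V | V.length = X.length ∧ IsConvergent V ∧
        (V.count 0 < X.count 0 ∨ (V.count 0 = X.count 0 ∧ V.count 4 < X.count 4))})) ≤
      Submodule.span ℚ (sym '' S) := by
    rw [Submodule.map_span_le]
    rintro _ ⟨V, ⟨hVlen, hVconv, hVlt⟩, rfl⟩
    rw [liftMap_sym, toQ_shuffle]
    exact sum_map_sym_mem_span fun w hw => hS V w hVlen hVconv hVlt hw
  exact key (Submodule.mem_map_of_mem hl)

/-! ## 3. The `p`-reduction, lexicographic version -/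

/-- **The `p`-reduction at a fixed length `n` (lexicographic version).** Assume E (every convergent
word with a letter `0` reduces lexicographically) at all lengths `< n`, and the end case at length `n`
for the words ENDING in `0` with `#0 ≤ #4`. Then every word `A ++ 0 :: B` of length `n` with a `0`-free
tail `B` and `#0 ≤ #4` reduces lexicographically: by strong induction on `|B|`, writing `[A0] ≡ lower`
(length `< n`) and multiplying by the convergent `0`-free word `B` (`rel` is a shuffle ideal):
`B ш [A0] = [A0B] + Σ [w' 0 B₂]` over proper tails `B₂` of `B`, and an interleaving of `B` with a word
lexicographically lower than `A0` is lexicographically lower than `A0B` (it has `#4(B)` more letters `4`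
and no more letters `0`). [folklore] -/
theorem elimLex_le_of_end_at {n : ℕ}
    (IHn : ∀ V : List (Fin 5), V.length < n → IsConvergent V → 0 < V.count 0 →
      sym V ∈ rel ⊔ Submodule.span ℚ (sym '' {V' | V'.length = V.length ∧ IsConvergent V' ∧
        (V'.count 0 < V.count 0 ∨ (V'.count 0 = V.count 0 ∧ V'.count 4 < V.count 4))}))
    (hEnd : ∀ W : List (Fin 5), W.length = n → IsConvergent W → W.getLast? = some 0 →
      W.count 0 ≤ W.count 4 →
      sym W ∈ rel ⊔ Submodule.span ℚ (sym '' {V | V.length = W.length ∧ IsConvergent V ∧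
        (V.count 0 < W.count 0 ∨ (V.count 0 = W.count 0 ∧ V.count 4 < W.count 4))})) :
    ∀ (k : ℕ) (A B : List (Fin 5)), B.length = k → (0 : Fin 5) ∉ B → (A ++ 0 :: B).length = n →
      IsConvergent (A ++ 0 :: B) → (A ++ 0 :: B).count 0 ≤ (A ++ 0 :: B).count 4 →
      sym (A ++ 0 :: B) ∈ rel ⊔ Submodule.span ℚ (sym '' {V | V.length = (A ++ 0 :: B).length ∧
        IsConvergent V ∧ (V.count 0 < (A ++ 0 :: B).count 0 ∨
          (V.count 0 = (A ++ 0 :: B).count 0 ∧ V.count 4 < (A ++ 0 :: B).count 4))}) := by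
  intro k
  induction k using Nat.strong_induction_on with
  | _ k ih =>
    intro A B hk hB hn hW h2
    by_cases hBnil : B = []
    · subst hBnil
      exact hEnd _ hn hW (by simp) h2
    -- `W = u ++ B` with `u = A ++ [0]` reducible at length `< n`
    have hWu : A ++ 0 :: B = (A ++ [0]) ++ B := by simp
    have hu : IsConvergent (A ++ [0]) := isConvergent_prefix_zero hW
    have hBc : IsConvergent B := isConvergent_tail hW hB hBnil
    have hBpos : 0 < B.length := List.length_pos_iff.2 hBnil
    have hulen : (A ++ [0]).length < n := by
      rw [← hn]
      simp only [List.length_append, List.length_cons, List.length_nil]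
      omega
    have hu0 : 0 < (A ++ [0]).count 0 := by simp
    have hured := IHn _ hulen hu hu0
    -- letter counts of `W = A0B` versus `A0` and `B`
    have hWcnt : ∀ a : Fin 5, (A ++ 0 :: B).count a = (A ++ [0]).count a + B.count a := fun a => by
      simp only [List.count_append, List.count_cons, List.count_nil]
      omega
    have hB0 : B.count 0 = 0 := List.count_eq_zero.2 hB
    -- the product `B ш u` lies in `rel ⊔ LEX W`
    have hprod : toQ (shuffle B (A ++ [0])) ∈ rel ⊔
        Submodule.span ℚ (sym '' {V | V.length = (A ++ 0 :: B).length ∧ IsConvergent V ∧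
          (V.count 0 < (A ++ 0 :: B).count 0 ∨
            (V.count 0 = (A ++ 0 :: B).count 0 ∧ V.count 4 < (A ++ 0 :: B).count 4))}) := by
      refine shuffle_mem_of_lexReducible hBc hured fun V w hVlen hVconv hVlt hw => ⟨?_, ?_, ?_⟩
      · rw [MZV.length_of_mem_shuffleWord B V hw, hVlen]
        simp only [List.length_append, List.length_cons, List.length_nil]
        omega
      · exact isConvergent_of_mem_shuffleWord hBc hVconv hw
      · rw [count_of_mem_shuffleWord hw 0, count_of_mem_shuffleWord hw 4, hWcnt 0, hWcnt 4, hB0]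
        omega
    rw [toQ_shuffle] at hprod
    -- isolate `[W]`: every other interleaving has a shorter `0`-free tail
    refine sym_mem_of_sum_mem (hWu ▸ append_mem_shuffleWord B (A ++ [0])) hprod fun w hw hne => ?_
    rcases mem_shuffleWord_append_zero B (A ++ [0]) hw hB A rfl with
      h | ⟨v₁, v₂, w', hsplit, hv₁, hw', rfl⟩
    · exact absurd (h.trans hWu.symm) hne
    · -- `w = w' ++ 0 :: v₂` with `|v₂| < |B|`: inner induction hypothesis
      have hv₂len : v₂.length < k := by
        rw [← hk, hsplit, List.length_append]
        exact Nat.lt_add_of_pos_left (List.length_pos_iff.2 hv₁)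
      have hv₂ : (0 : Fin 5) ∉ v₂ := fun h => hB (hsplit ▸ List.mem_append_right v₁ h)
      have hcount : ∀ a : Fin 5, (w' ++ 0 :: v₂).count a = (A ++ 0 :: B).count a := fun a => by
        rw [count_of_mem_shuffleWord hw a]
        simp only [List.count_append, List.count_cons, List.count_nil]
        omega
      have hlen : (w' ++ 0 :: v₂).length = n := by
        rw [← hn, MZV.length_of_mem_shuffleWord B (A ++ [0]) hw]
        simp only [List.length_append, List.length_cons, List.length_nil]
        omega
      have hconv : IsConvergent (w' ++ 0 :: v₂) := isConvergent_of_mem_shuffleWord hBc hu hw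
      have hle : (w' ++ 0 :: v₂).count 0 ≤ (w' ++ 0 :: v₂).count 4 := by
        rw [hcount 0, hcount 4]; exact h2
      have := ih _ hv₂len w' v₂ rfl hv₂ hlen hconv hle
      rwa [lexSpan_congr (hlen.trans hn.symm) (hcount 0) (hcount 4)] at this

end ElimLex

/-! ## 4. The registered stub: E from E1 and the end case, lexicographic version -/

/-- **Stub E-glue (all weights): the landed glue `ElimEnd.elim_of_gt_of_end` re-targeted to the
lexicographic span.** Every convergent word with a letter `0` reduces, modulo `rel`, to convergent words
of the same length with fewer letters `0` or with as many letters `0` and fewer letters `4`, given (E1)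
`#4 < #0 ⇒` reduces to fewer letters `0` (landed, `stub_elim_gt`) and (End) every convergent word
ENDING in `0` with `#0 ≤ #4` reduces lexicographically whenever all shorter convergent words with a
letter `0` do.  Strong induction on the length: E1 words via `lowerSpan W ≤ LEX W`
(`ElimLex.lowerSpan_le_lexSpan`), the others are `A ++ 0 :: B` with `B` `0`-free
(`ElimEnd.exists_split_last`) and `ElimLex.elimLex_le_of_end_at` applies (shuffling by the `0`-free
word `B` adds no letter `0` and exactly `#4(B)` letters `4`). [cite: Zhao2010, §2 Lemma 2.2] -/
theorem stub_elim_lex_glue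
    (hE1 : ∀ V : List (Fin 5), IsConvergent V → V.count 4 < V.count 0 → sym V ∈ rel ⊔ lowerSpan V)
    (hEnd : ∀ W : List (Fin 5), (∀ V : List (Fin 5), V.length < W.length → IsConvergent V →
      0 < V.count 0 → sym V ∈ rel ⊔ Submodule.span ℚ (sym '' {V' | V'.length = V.length ∧ IsConvergent V' ∧
        (V'.count 0 < V.count 0 ∨ (V'.count 0 = V.count 0 ∧ V'.count 4 < V.count 4))})) →
      IsConvergent W → W.getLast? = some 0 → W.count 0 ≤ W.count 4 → sym W ∈ rel ⊔ Submodule.span ℚ (sym '' {V | V.length = W.length ∧ IsConvergent V ∧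
      (V.count 0 < W.count 0 ∨ (V.count 0 = W.count 0 ∧ V.count 4 < W.count 4))}))
    (W : List (Fin 5)) (hW : IsConvergent W) (h1 : 0 < W.count 0) :
    sym W ∈ rel ⊔ Submodule.span ℚ (sym '' {V | V.length = W.length ∧ IsConvergent V ∧
      (V.count 0 < W.count 0 ∨ (V.count 0 = W.count 0 ∧ V.count 4 < W.count 4))}) := by
  suffices key : ∀ n : ℕ, ∀ W : List (Fin 5), W.length = n → IsConvergent W → 0 < W.count 0 →
      sym W ∈ rel ⊔ Submodule.span ℚ (sym '' {V | V.length = W.length ∧ IsConvergent V ∧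
        (V.count 0 < W.count 0 ∨ (V.count 0 = W.count 0 ∧ V.count 4 < W.count 4))}) from
    key _ W rfl hW h1
  intro n
  induction n using Nat.strong_induction_on with
  | _ n ihn =>
    intro W hn hW h1
    rcases lt_or_ge (W.count 4) (W.count 0) with hgt | hle
    · exact sup_le_sup_left (ElimLex.lowerSpan_le_lexSpan W) _ (hE1 W hW hgt)
    · have IHn : ∀ V : List (Fin 5), V.length < n → IsConvergent V → 0 < V.count 0 →
          sym V ∈ rel ⊔ Submodule.span ℚ (sym '' {V' | V'.length = V.length ∧ IsConvergent V' ∧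
            (V'.count 0 < V.count 0 ∨ (V'.count 0 = V.count 0 ∧ V'.count 4 < V.count 4))}) :=
        fun V hV => ihn V.length (hn ▸ hV) V rfl
      obtain ⟨A, B, rfl, hB⟩ := ElimEnd.exists_split_last (0 : Fin 5) (List.count_pos_iff.1 h1)
      exact ElimLex.elimLex_le_of_end_at IHn (fun W' hW'n => hEnd W' (hW'n ▸ IHn)) B.length A B rfl
        hB hn hW hle

end Summit.KontsevichZagierPeriods.OctahedralSymmetry.OctaSpan

end
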